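import Summits.ABC.ABC.Theses.IneffectiveSubspace
import Literature.NumberTheory.DiophantineGeometry.AbcImpliesHall

/-!
# `TowerExponentWindow` (stmt-ABC-1647), line `binomial-xi-d-zero-threefold` — stub B
`stub_flatBoundOfDepth`: the binomial depth inequality at level `n` gives Vojta's `D = 0` flat bound

This file proves the registered stub `stub_flatBoundOfDepth` of the skeleton
`Cruxes/TowerExponentWindow/Lines/binomial-xi-d-zero-threefold.lean` (the DICTIONARY step of the line,
Vojta 2000 §7, the `D = 0` threefold `uxⁿ + vyⁿ + wzⁿ = 0 ⊂ ℙ² × ℙ²`).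

**Statement.** Fix a level `n`, constants `0 ≤ C`, `3C < n`, `C'`, and assume the *binomial depth
inequality* at level `n`: for positive `a₁ a₂ c₁ c₂` with `gcd(a₁a₂, c₁c₂) = 1` and `a₁a₂ⁿ ≠ c₁c₂ⁿ`, every
positive divisor `d` of `a₁a₂ⁿ − c₁c₂ⁿ` (in `ℤ`) has
`log d ≤ C·(log max(a₁,c₁) + log max(a₂,c₂) + log rad d) + C'`.  Then there are `κ, K` with
`wZⁿ ≤ K·(uvw)^κ` for every positive solution of `uXⁿ + vYⁿ = wZⁿ` with `gcd(uXⁿ, vYⁿ) = 1`.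

**Proof** (pure bookkeeping over `ℝ`).  Put `L = log(uvw)`, `ℓ = log(wZⁿ)`, `S = log X + log Y`.
1. The depth inequality at `(a₁,a₂,c₁,c₂) = (u,X,w,Z)` with `d = Yⁿ` (admissible: `uXⁿ − wZⁿ = −vYⁿ`,
   `gcd(uX, wZ) = 1` because `gcd(uXⁿ, uXⁿ + vYⁿ) = 1`, and `uXⁿ ≠ wZⁿ` as `vYⁿ > 0`) gives
   `n log Y ≤ C·(log max(u,w) + log max(X,Z) + log rad(Yⁿ)) + C'`; with `max(u,w) ≤ uvw`,
   `max(X,Z)ⁿ ≤ wZⁿ`, `rad(Yⁿ) ≤ Y` and `C ≥ 0`: `(n − C) log Y ≤ C·L + C·ℓ/n + C'`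
   (`FlatBoundOfDepth.depth_step`).
2. Symmetrically at `(v,Y,w,Z)`, `d = Xⁿ`: `(n − C) log X ≤ C·L + C·ℓ/n + C'`.
3. Adding: `(n − C)·S ≤ 2C·L + 2C·ℓ/n + 2C'`.
4. `wZⁿ = uXⁿ + vYⁿ ≤ 2·uXⁿ·vYⁿ ≤ 2uvw(XY)ⁿ`, so `ℓ ≤ log 2 + L + n·S`.
5. Eliminating `S` (here `3C < n` is used): `(n − 3C)·ℓ ≤ (n − C + 2nC)·L + (n − C) log 2 + 2nC'`.
6. Exponentiate: `wZⁿ ≤ K·(uvw)^κ` with `κ = (n − C + 2nC)/(n − 3C)`,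
   `K = exp(((n − C) log 2 + 2nC')/(n − 3C))` (`FlatBoundOfDepth.flat_of_depth`).

Sources: Vojta, *On the ABC conjecture and diophantine approximation by rational points* (2000), §3.1 and §7
(Prop. 7.2, Rem. 7.3) [Vojta2000ABC]; the skeleton's docstring of `FlatBoundOfDepth`.  Uses only Mathlib and
`Literature.NumberTheory.DiophantineGeometry.radical_le_of_dvd_pow`.  Deliberately NOT here: the lever
(`stub_binomialDepthWindow`, open) and the lift to polynomial abc (`stub_polyAbcOfFlatBound`), which are
other stubs of the line.
-/

-- `Summit.<Summit>.<Problem>` is the mandated summit-side namespace (CONVENTIONS §2); for the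
-- single-conjunct summit `ABC` the two coincide, so the duplicate `ABC.ABC` is deliberate.
set_option linter.dupNamespace false

namespace Summit.ABC.ABC.Theorems

open Literature.NumberTheory.DiophantineGeometry (radical_le_of_dvd_pow)

/-- Monotonicity of `Real.log` along `ℕ → ℝ`, including the junk value `log 0 = 0`:
`a ≤ b` in `ℕ` gives `log a ≤ log b`. [folklore] -/
theorem FlatBoundOfDepth.log_natCast_mono {a b : ℕ} (h : a ≤ b) :
    Real.log (a : ℝ) ≤ Real.log (b : ℝ) := by
  rcases Nat.eq_zero_or_pos a with rfl | ha
  · rw [Nat.cast_zero, Real.log_zero]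
    exact Real.log_natCast_nonneg b
  · exact Real.log_le_log (by exact_mod_cast ha) (by exact_mod_cast h)

/-- **Step (1) of the dictionary** (Vojta 2000 §7, one application of the depth inequality).  If the
binomial depth inequality holds at level `n ≠ 0` with constants `0 ≤ C`, `C'`, then for every positive
solution of `uXⁿ + vYⁿ = wZⁿ` with `gcd(uXⁿ, vYⁿ) = 1`,
`(n − C)·log Y ≤ C·log(uvw) + C·log(wZⁿ)/n + C'`: apply the hypothesis to `(a₁,a₂,c₁,c₂) = (u,X,w,Z)` and
the divisor `d = Yⁿ` of `uXⁿ − wZⁿ = −vYⁿ`, and use `max(u,w) ≤ uvw`, `max(X,Z)ⁿ ≤ wZⁿ`, `rad(Yⁿ) ≤ Y`.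
[cite: Vojta2000ABC, §7] -/
theorem FlatBoundOfDepth.depth_step {n : ℕ} {C C' : ℝ} (hC : 0 ≤ C) (hn : n ≠ 0)
    (h : ∀ a₁ a₂ c₁ c₂ : ℕ, 0 < a₁ → 0 < a₂ → 0 < c₁ → 0 < c₂ → Nat.Coprime (a₁ * a₂) (c₁ * c₂) →
      a₁ * a₂ ^ n ≠ c₁ * c₂ ^ n → ∀ d : ℕ, 0 < d →
      (d : ℤ) ∣ ((a₁ * a₂ ^ n : ℕ) : ℤ) - ((c₁ * c₂ ^ n : ℕ) : ℤ) →
      Real.log (d : ℝ) ≤ C * (Real.log ((max a₁ c₁ : ℕ) : ℝ) + Real.log ((max a₂ c₂ : ℕ) : ℝ) +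
        Real.log ((UniqueFactorizationMonoid.radical d : ℕ) : ℝ)) + C')
    {u v w X Y Z : ℕ} (hu : 0 < u) (hv : 0 < v) (hw : 0 < w) (hX : 0 < X) (hY : 0 < Y) (hZ : 0 < Z)
    (heq : u * X ^ n + v * Y ^ n = w * Z ^ n) (hcop : Nat.Coprime (u * X ^ n) (v * Y ^ n)) :
    ((n : ℝ) - C) * Real.log (Y : ℝ) ≤
      C * Real.log ((u * v * w : ℕ) : ℝ) + C * (Real.log ((w * Z ^ n : ℕ) : ℝ) / n) + C' := by
  -- admissibility of the data `(u, X, w, Z)` and of the divisor `d = Yⁿ`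
  have hcop' : Nat.Coprime (u * X) (w * Z) := by
    have h1 : Nat.Coprime (u * X ^ n) (w * Z ^ n) := by
      rw [← heq]
      exact Nat.coprime_self_add_right.mpr hcop
    exact Nat.Coprime.coprime_dvd_right (mul_dvd_mul_left w (dvd_pow_self Z hn))
      (Nat.Coprime.coprime_dvd_left (mul_dvd_mul_left u (dvd_pow_self X hn)) h1)
  have hvY : 0 < v * Y ^ n := mul_pos hv (pow_pos hY n)
  have hne : u * X ^ n ≠ w * Z ^ n := by omega
  have hdvd : ((Y ^ n : ℕ) : ℤ) ∣ ((u * X ^ n : ℕ) : ℤ) - ((w * Z ^ n : ℕ) : ℤ) := by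
    have hz : ((u * X ^ n : ℕ) : ℤ) - ((w * Z ^ n : ℕ) : ℤ) = -((v * Y ^ n : ℕ) : ℤ) := by
      rw [← heq]
      push_cast
      ring
    rw [hz, dvd_neg]
    exact Int.natCast_dvd_natCast.mpr (dvd_mul_left _ _)
  have hd := h u X w Z hu hX hw hZ hcop' hne (Y ^ n) (pow_pos hY n) hdvd
  -- the three height terms
  have h1 : Real.log ((max u w : ℕ) : ℝ) ≤ Real.log ((u * v * w : ℕ) : ℝ) :=
    FlatBoundOfDepth.log_natCast_mono (max_le
      ((Nat.le_mul_of_pos_right u hv).trans (Nat.le_mul_of_pos_right _ hw))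
      (Nat.le_mul_of_pos_left w (mul_pos hu hv)))
  have hn' : (0 : ℝ) < n := by exact_mod_cast Nat.pos_of_ne_zero hn
  have h2 : Real.log ((max X Z : ℕ) : ℝ) ≤ Real.log ((w * Z ^ n : ℕ) : ℝ) / n := by
    rw [le_div_iff₀ hn', mul_comm, ← Real.log_pow, ← Nat.cast_pow]
    apply FlatBoundOfDepth.log_natCast_mono
    rcases le_total X Z with hXZ | hZX
    · rw [max_eq_right hXZ]
      exact Nat.le_mul_of_pos_left _ hw
    · rw [max_eq_left hZX]
      calc X ^ n ≤ u * X ^ n := Nat.le_mul_of_pos_left _ hu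
        _ ≤ u * X ^ n + v * Y ^ n := Nat.le_add_right _ _
        _ = w * Z ^ n := heq
  have h3 : Real.log ((UniqueFactorizationMonoid.radical (Y ^ n) : ℕ) : ℝ) ≤ Real.log (Y : ℝ) :=
    FlatBoundOfDepth.log_natCast_mono (radical_le_of_dvd_pow hY.ne' dvd_rfl)
  have h4 : Real.log ((Y ^ n : ℕ) : ℝ) = n * Real.log (Y : ℝ) := by
    rw [Nat.cast_pow, Real.log_pow]
  have h5 := mul_le_mul_of_nonneg_left (add_le_add (add_le_add h1 h2) h3) hC
  rw [h4] at hd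
  linarith

/-- **The dictionary with explicit constants** (Vojta 2000 §7, `D = 0` on the threefold
`uxⁿ + vyⁿ + wzⁿ = 0`): under the binomial depth inequality at level `n` with `0 ≤ C`, `3C < n`, every
positive solution of `uXⁿ + vYⁿ = wZⁿ` with `gcd(uXⁿ, vYⁿ) = 1` satisfies
`wZⁿ ≤ exp(((n − C) log 2 + 2nC')/(n − 3C)) · (uvw)^((n − C + 2nC)/(n − 3C))`.
Steps (2)–(6) of the module docstring. [cite: Vojta2000ABC, §7] -/
theorem FlatBoundOfDepth.flat_of_depth {n : ℕ} {C C' : ℝ} (hC : 0 ≤ C) (hCn : 3 * C < n)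
    (h : ∀ a₁ a₂ c₁ c₂ : ℕ, 0 < a₁ → 0 < a₂ → 0 < c₁ → 0 < c₂ → Nat.Coprime (a₁ * a₂) (c₁ * c₂) →
      a₁ * a₂ ^ n ≠ c₁ * c₂ ^ n → ∀ d : ℕ, 0 < d →
      (d : ℤ) ∣ ((a₁ * a₂ ^ n : ℕ) : ℤ) - ((c₁ * c₂ ^ n : ℕ) : ℤ) →
      Real.log (d : ℝ) ≤ C * (Real.log ((max a₁ c₁ : ℕ) : ℝ) + Real.log ((max a₂ c₂ : ℕ) : ℝ) +
        Real.log ((UniqueFactorizationMonoid.radical d : ℕ) : ℝ)) + C')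
    {u v w X Y Z : ℕ} (hu : 0 < u) (hv : 0 < v) (hw : 0 < w) (hX : 0 < X) (hY : 0 < Y) (hZ : 0 < Z)
    (heq : u * X ^ n + v * Y ^ n = w * Z ^ n) (hcop : Nat.Coprime (u * X ^ n) (v * Y ^ n)) :
    ((w * Z ^ n : ℕ) : ℝ) ≤
      Real.exp ((((n : ℝ) - C) * Real.log 2 + 2 * n * C') / (n - 3 * C)) *
        ((u * v * w : ℕ) : ℝ) ^ (((n : ℝ) - C + 2 * n * C) / (n - 3 * C)) := by
  have hn0 : (0 : ℝ) < n := by linarith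
  have hn : n ≠ 0 := by
    rintro rfl
    simp at hn0
  have hD : (0 : ℝ) < n - 3 * C := by linarith
  have hnC : (0 : ℝ) ≤ n - C := by linarith
  -- steps (1) and (2): the depth inequality at `(u,X,w,Z), d = Yⁿ` and at `(v,Y,w,Z), d = Xⁿ`
  have hY' := FlatBoundOfDepth.depth_step hC hn h hu hv hw hX hY hZ heq hcop
  have hX' := FlatBoundOfDepth.depth_step hC hn h hv hu hw hY hX hZ ((add_comm _ _).trans heq) hcop.symm
  rw [Nat.mul_comm v u] at hX'
  have huvw : (0 : ℝ) < ((u * v * w : ℕ) : ℝ) := by exact_mod_cast mul_pos (mul_pos hu hv) hw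
  have hwZ : (0 : ℝ) < ((w * Z ^ n : ℕ) : ℝ) := by exact_mod_cast mul_pos hw (pow_pos hZ n)
  obtain ⟨L, hL⟩ : ∃ L, Real.log ((u * v * w : ℕ) : ℝ) = L := ⟨_, rfl⟩
  obtain ⟨ℓ, hℓ⟩ : ∃ ℓ, Real.log ((w * Z ^ n : ℕ) : ℝ) = ℓ := ⟨_, rfl⟩
  rw [hL, hℓ] at hX' hY'
  -- step (4): `wZⁿ ≤ 2uvw(XY)ⁿ`
  have h4 : ℓ ≤ Real.log 2 + L + n * (Real.log (X : ℝ) + Real.log (Y : ℝ)) := by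
    have ha : (1 : ℝ) ≤ (u : ℝ) * (X : ℝ) ^ n := by exact_mod_cast mul_pos hu (pow_pos hX n)
    have hb : (1 : ℝ) ≤ (v : ℝ) * (Y : ℝ) ^ n := by exact_mod_cast mul_pos hv (pow_pos hY n)
    have hw1 : (1 : ℝ) ≤ w := by exact_mod_cast hw
    have heqR : (u : ℝ) * (X : ℝ) ^ n + v * (Y : ℝ) ^ n = w * (Z : ℝ) ^ n := by exact_mod_cast heq
    have hreal : ((w * Z ^ n : ℕ) : ℝ) ≤ 2 * ((u * v * w : ℕ) : ℝ) * ((X : ℝ) * Y) ^ n := by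
      push_cast
      calc (w : ℝ) * (Z : ℝ) ^ n = u * (X : ℝ) ^ n + v * (Y : ℝ) ^ n := heqR.symm
        _ ≤ 2 * ((u : ℝ) * (X : ℝ) ^ n) * ((v : ℝ) * (Y : ℝ) ^ n) := by
          nlinarith [mul_nonneg (sub_nonneg.2 ha) (sub_nonneg.2 hb)]
        _ ≤ 2 * ((u : ℝ) * (X : ℝ) ^ n) * ((v : ℝ) * (Y : ℝ) ^ n) * w :=
          le_mul_of_one_le_right (by positivity) hw1
        _ = 2 * ((u : ℝ) * v * w) * ((X : ℝ) * Y) ^ n := by ring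
    calc ℓ = Real.log ((w * Z ^ n : ℕ) : ℝ) := hℓ.symm
      _ ≤ Real.log (2 * ((u * v * w : ℕ) : ℝ) * ((X : ℝ) * Y) ^ n) := Real.log_le_log hwZ hreal
      _ = Real.log 2 + L + n * (Real.log (X : ℝ) + Real.log (Y : ℝ)) := by
        rw [Real.log_mul (by positivity) (by positivity), Real.log_mul two_ne_zero huvw.ne',
          Real.log_pow, Real.log_mul (by positivity) (by positivity), hL]
  -- steps (3) and (5): add the two depth bounds and eliminate `log X + log Y`
  have h5 : ((n : ℝ) - 3 * C) * ℓ ≤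
      ((n : ℝ) - C + 2 * n * C) * L + ((n : ℝ) - C) * Real.log 2 + 2 * n * C' := by
    have hS := mul_le_mul_of_nonneg_left (add_le_add hX' hY') hn0.le
    have h4' := mul_le_mul_of_nonneg_left h4 hnC
    have hdiv : (n : ℝ) * (C * (ℓ / n)) = C * ℓ := by
      rw [mul_div_assoc', mul_div_assoc', mul_div_cancel_left₀ _ hn0.ne']
    linarith
  -- step (6): divide by `n − 3C > 0` and exponentiate
  have h6 : ℓ ≤ (((n : ℝ) - C) * Real.log 2 + 2 * n * C') / (n - 3 * C) +
      L * (((n : ℝ) - C + 2 * n * C) / (n - 3 * C)) := by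
    rw [mul_div_assoc', ← add_div, le_div_iff₀ hD]
    linarith
  calc ((w * Z ^ n : ℕ) : ℝ) = Real.exp ℓ := by rw [← hℓ, Real.exp_log hwZ]
    _ ≤ Real.exp ((((n : ℝ) - C) * Real.log 2 + 2 * n * C') / (n - 3 * C) +
          L * (((n : ℝ) - C + 2 * n * C) / (n - 3 * C))) := Real.exp_le_exp.mpr h6
    _ = Real.exp ((((n : ℝ) - C) * Real.log 2 + 2 * n * C') / (n - 3 * C)) *
          ((u * v * w : ℕ) : ℝ) ^ (((n : ℝ) - C + 2 * n * C) / (n - 3 * C)) := by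
      rw [Real.rpow_def_of_pos huvw, ← Real.exp_add, hL]

/-- **Stub B of line `binomial-xi-d-zero-threefold` (registered form, verbatim): the binomial depth
inequality at level `n` with `0 ≤ C`, `3C < n` implies Vojta's `D = 0` flat bound at level `n`** — on
positive solutions of `uXⁿ + vYⁿ = wZⁿ` with `gcd(uXⁿ, vYⁿ) = 1`, `wZⁿ ≤ K·(uvw)^κ` for some `κ, K`
(namely `κ = (n − C + 2nC)/(n − 3C)`, `K = exp(((n − C) log 2 + 2nC')/(n − 3C))`, see
`FlatBoundOfDepth.flat_of_depth`).  This is the dictionary "tower top coordinate ↔ binomial form" of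
Vojta 2000 §7 (the threefold `uxⁿ + vyⁿ + wzⁿ = 0 ⊂ ℙ² × ℙ²`, Prop. 7.2 / Rem. 7.3), pure bookkeeping
over `ℝ`. [cite: Vojta2000ABC, §7] -/
theorem stub_flatBoundOfDepth : ∀ n : ℕ, ∀ C C' : ℝ, 0 ≤ C → 3 * C < n → (∀ a₁ a₂ c₁ c₂ : ℕ, 0 < a₁ → 0 < a₂ → 0 < c₁ → 0 < c₂ → Nat.Coprime (a₁ * a₂) (c₁ * c₂) → a₁ * a₂ ^ n ≠ c₁ * c₂ ^ n → ∀ d : ℕ, 0 < d → (d : ℤ) ∣ ((a₁ * a₂ ^ n : ℕ) : ℤ) - ((c₁ * c₂ ^ n : ℕ) : ℤ) → Real.log (d : ℝ) ≤ C * (Real.log ((max a₁ c₁ : ℕ) : ℝ) + Real.log ((max a₂ c₂ : ℕ) : ℝ) + Real.log ((UniqueFactorizationMonoid.radical d : ℕ) : ℝ)) + C') → ∃ κ K : ℝ, ∀ u v w X Y Z : ℕ, 0 < u → 0 < v → 0 < w → 0 < X → 0 < Y → 0 < Z → u * X ^ n + v * Y ^ n = w * Z ^ n → Nat.Coprime (u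 * X ^ n) (v * Y ^ n) → ((w * Z ^ n : ℕ) : ℝ) ≤ K * ((u * v * w : ℕ) : ℝ) ^ κ := by
  intro n C C' hC hCn h
  exact ⟨_, _, fun u v w X Y Z hu hv hw hX hY hZ heq hcop =>
    FlatBoundOfDepth.flat_of_depth hC hCn h hu hv hw hX hY hZ heq hcop⟩

end Summit.ABC.ABC.Theorems
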